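import Literature.NumberTheory.EllipticCurves.Kato2004.ZetaIndexInequalitySkeletonProofs
import Literature.NumberTheory.EllipticCurves.Kato2004.HullDescentSkeletonProofs
import HarnessLib

/-!
# Kato 2004, §14.14 WITHOUT the divisibility at `(p)`: the zeta-index inequality with the
# `μ`-invariant of `𝐇²(T)` as the only defect — `ord_p #(H2/TH2) ≤ ord_p [A : z] + μ(H2)`
# (module theory over `ℤ_p⟦T⟧`; companion of `ZetaIndexInequalitySkeletonProofs`)

K. Kato, *`p`-adic Hodge theory and values of zeta functions of modular forms*, Astérisque **295**
(2004) [Kato2004Asterisque]. Thm. 12.5 **(3)** (p. 222) gives the length inequality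
`length_{Λ_𝔮} 𝐇²_𝔮 ≤ length_{Λ_𝔮} (𝐇¹/Z)_𝔮` at every height-one prime `𝔮` of `Λ` which does NOT
contain `p`, with NO hypothesis on the image of the Galois representation; the inequality at the one
height-one prime `(p)` containing `p` — i.e. the comparison of `μ`-invariants — is part (4) and needs
(12.5.2). This file runs Kato's §14.14 descent (Lemma 14.15, (14.14.1)–(14.14.2)) with the divisibility
assumed only OFF `(p)`: the conclusion of Thm. 14.5 (3), `#H²(ℤ[1/p],T) ≤ [H¹(ℤ[1/p],T) : z]`, survives
up to exactly ONE named defect, the `μ`-invariant of `𝐇²(T)` (the tree's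
`Literature.NumberTheory.EllipticCurves.muInvariant`):
**`ord_p #(H2/TH2) ≤ ord_p [A : Λ·ι z̄] + μ(H2)`**
(`Kato2004.padicValNat_natCard_coinvariants_le_add_muInvariant_of_lengthAt_le_off_augIdealP`), after the
monotonicity `e(M) ≤ e(N) + μ(M)` of the `Γ`-Euler exponent under termwise inequalities off `(p)`
(`Kato2004.eulerExp_le_add_muInvariant_of_lengthAt_le_off_augIdealP`; the `(p)`-term of `e(M)` is
`μ(M) · v_p(q_{(p)}(0)) = μ(M)`). With `μ(H2) = 0` this is Thm. 14.5 (3) verbatim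
(`Kato2004.exists_index_zeta_eq_pow_mul_natCard_coinvariants_of_muInvariant_eq_zero`). Theorems only; no
definition, no named fact; nothing about Kato's objects is asserted (cell `bsd-potss`, seat `k9-c4`;
consumer: the irreducible non-surjective rows of the upper half,
`Summits/BirchSwinnertonDyer/Rank1Residual/Additive/KatoDescentIrreducibleReadings.lean`).

References: [Kato2004Asterisque] Thm. 12.5 (3)–(4) and (12.5.2) (p. 222), Thm. 14.5 (3) (p. 236),
§14.14 (14.14.1)–(14.14.2) and Lemma 14.15 (pp. 243–244); [Washington1997] §13.2 (the `μ`-invariant).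
-/

noncomputable section

open scoped Classical

universe u

namespace Literature.NumberTheory.EllipticCurves.Kato2004

open Literature.NumberTheory.EllipticCurves.IwasawaAlgebra

variable {p : ℕ} [Fact p.Prime]

section Monotone

/-- **Monotonicity of the `Γ`-Euler exponent OFF `(p)`**: if `ℓ_𝔮(M) ≤ ℓ_𝔮(N)` at every height-one
prime `𝔮 ≠ (p)` (Thm. 12.5 (3): the primes not containing `p`), then `e(M) ≤ e(N) + μ(M)` — the only
summand of `e(M)` not controlled is the one at `(p)`, which is `μ(M) · v_p(q_{(p)}(0)) = μ(M)`.
[cite: Kato2004Asterisque, Thm. 12.5 (3) (p. 222), Lemma 14.15 (p. 244)] [cite: Washington1997, §13.2] -/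
theorem eulerExp_le_add_muInvariant_of_lengthAt_le_off_augIdealP {M N : Type u} [AddCommGroup M]
    [Module (IwasawaAlgebra p) M] [AddCommGroup N] [Module (IwasawaAlgebra p) N]
    [Module.Finite (IwasawaAlgebra p) M] [Module.Finite (IwasawaAlgebra p) N]
    (hM : Module.IsTorsion (IwasawaAlgebra p) M) (hN : Module.IsTorsion (IwasawaAlgebra p) N)
    (h : ∀ 𝔮 : PrimeSpectrum (IwasawaAlgebra p), 𝔮.asIdeal.height = 1 →
      𝔮.asIdeal ≠ augIdealP p →
      Module.lengthAt (IwasawaAlgebra p) M 𝔮 ≤ Module.lengthAt (IwasawaAlgebra p) N 𝔮) :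
    eulerExp p M ≤ eulerExp p N + muInvariant p M := by
  -- the point `(p)` of `Spec Λ`
  let 𝔭 : PrimeSpectrum (IwasawaAlgebra p) := ⟨augIdealP p, isPrime_augIdealP_holds p⟩
  have h𝔭 : 𝔭.asIdeal = augIdealP p := rfl
  have h𝔭mem : 𝔭 ∈ heightOneNeT p := mem_heightOneNeT_of_asIdeal_eq_augIdealP 𝔭 h𝔭
  -- a common finite index set containing `𝔭`
  have hSM := finite_heightOneNeT_inter_support M hM
  have hSN := finite_heightOneNeT_inter_support N hN
  set S : Finset (PrimeSpectrum (IwasawaAlgebra p)) := insert 𝔭 (hSM.union hSN).toFinset with hS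
  have hsubM : heightOneNeT p ∩ Function.support (fun 𝔮 ↦
      (Module.lengthAt (IwasawaAlgebra p) M 𝔮).toNat * constVal p 𝔮) ⊆ S := by
    intro x hx
    rw [hS, Finset.coe_insert, Set.Finite.coe_toFinset]
    exact Or.inr (Or.inl hx)
  have hsubN : heightOneNeT p ∩ Function.support (fun 𝔮 ↦
      (Module.lengthAt (IwasawaAlgebra p) N 𝔮).toNat * constVal p 𝔮) ⊆ S := by
    intro x hx
    rw [hS, Finset.coe_insert, Set.Finite.coe_toFinset]
    exact Or.inr (Or.inr hx)
  have hSsub : (S : Set (PrimeSpectrum (IwasawaAlgebra p))) ⊆ heightOneNeT p := by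
    intro x hx
    rw [hS, Finset.coe_insert, Set.Finite.coe_toFinset] at hx
    rcases hx with hx | hx | hx
    · rw [hx]; exact h𝔭mem
    · exact hx.1
    · exact hx.1
  have h𝔭S : 𝔭 ∈ S := by rw [hS]; exact Finset.mem_insert_self _ _
  unfold eulerExp
  rw [finsum_mem_eq_sum_of_subset _ hsubM hSsub, finsum_mem_eq_sum_of_subset _ hsubN hSsub,
    ← Finset.add_sum_erase S _ h𝔭S, ← Finset.add_sum_erase S _ h𝔭S]
  -- the `(p)`-term of `e(M)` is `μ(M)`
  have hμ : (Module.lengthAt (IwasawaAlgebra p) M 𝔭).toNat * constVal p 𝔭 = muInvariant p M := by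
    rw [constVal_eq_one_of_asIdeal_eq_augIdealP 𝔭 h𝔭, mul_one, muInvariant_eq_toNat_lengthAt p M 𝔭 h𝔭]
  -- termwise off `(p)`
  have hle : ∑ i ∈ S.erase 𝔭, (Module.lengthAt (IwasawaAlgebra p) M i).toNat * constVal p i ≤
      ∑ i ∈ S.erase 𝔭, (Module.lengthAt (IwasawaAlgebra p) N i).toNat * constVal p i := by
    refine Finset.sum_le_sum fun i hi ↦ ?_
    obtain ⟨hi𝔭, hiS⟩ := Finset.mem_erase.mp hi
    have hi' := hSsub (Finset.mem_coe.mpr hiS)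
    have hne : i.asIdeal ≠ augIdealP p := fun heq ↦ hi𝔭 (PrimeSpectrum.ext (heq.trans h𝔭.symm))
    exact Nat.mul_le_mul_right _ (ENat.toNat_le_toNat (h i hi'.1 hne)
      (IwasawaAlgebra.lengthAt_ne_top_of_isTorsion N hN i (le_of_eq hi'.1)))
  rw [hμ]
  omega

end Monotone

section Inequality

variable {H H2 A : Type u} [AddCommGroup H] [Module (IwasawaAlgebra p) H]
  [AddCommGroup H2] [Module (IwasawaAlgebra p) H2] [AddCommGroup A] [Module (IwasawaAlgebra p) A]
  [Module.Finite (IwasawaAlgebra p) H] [NoZeroSMulDivisors (IwasawaAlgebra p) H]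
  [Module.Finite (IwasawaAlgebra p) H2]

/-- **Kato's §14.14 descent with the divisibility only OFF `(p)` (Thm. 12.5 (3)): the zeta-index
inequality up to the `μ`-invariant of `𝐇²(T)`** — `ord_p #(H2/TH2) ≤ ord_p [A : Λ·ι z̄] + μ(H2)`.
Data as in `index_zeta_eq_natCard_coinvariants_of_conj_12_10` (`H` finitely generated torsion free
with `H/Λz` torsion, `H2` finitely generated torsion, `0 → H/TH →ι A →π H2[T] → 0` exact, `H2/TH2`
finite) and `[A : Λ·ι z̄] ≠ 0` (the zeta element survives at the bottom layer: Thm. 14.5 (1)–(2) when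
`L(f,k/2) ≠ 0`). Proof: `[A : Λ·ι z̄] = #H2[T] · #((H/Λz)/T) = #H2[T] · p^{e(H/Λz)}`,
`#(H2/TH2) = #H2[T] · p^{e(H2)}` (Lemma 14.15), and `e(H2) ≤ e(H/Λz) + μ(H2)` termwise off `(p)`.
With the divisibility AT `(p)` as well (Thm. 12.5 (4), (12.5.2)) the defect is absent: that is
`exists_index_zeta_eq_pow_mul_natCard_coinvariants_of_index_ne_zero`.
[cite: Kato2004Asterisque, Thm. 12.5 (3) (p. 222), Thm. 14.5 (1)–(3) (p. 236), §14.14 (14.14.1)–(14.14.2) and Lemma 14.15 (pp. 243–244)]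
[cite: Washington1997, §13.2] -/
theorem padicValNat_natCard_coinvariants_le_add_muInvariant_of_lengthAt_le_off_augIdealP (z : H)
    (hz : z ≠ 0) (hHZ : Module.IsTorsion (IwasawaAlgebra p) (H ⧸ (IwasawaAlgebra p) ∙ z))
    (hH2 : Module.IsTorsion (IwasawaAlgebra p) H2)
    (hdiv : ∀ 𝔮 : PrimeSpectrum (IwasawaAlgebra p), 𝔮.asIdeal.height = 1 →
      𝔮.asIdeal ≠ augIdealP p →
      Module.lengthAt (IwasawaAlgebra p) H2 𝔮 ≤
        Module.lengthAt (IwasawaAlgebra p) (H ⧸ (IwasawaAlgebra p) ∙ z) 𝔮)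
    (ι : coinvariants p H →ₗ[IwasawaAlgebra p] A) (π : A →ₗ[IwasawaAlgebra p] invariants p H2)
    (hι : Function.Injective ι) (hπ : Function.Surjective π) (hex : Function.Exact ι π)
    (hfin : Finite (coinvariants p H2))
    (hne : Nat.card (A ⧸ (IwasawaAlgebra p) ∙ ι (Submodule.Quotient.mk z)) ≠ 0) :
    padicValNat p (Nat.card (coinvariants p H2)) ≤
      padicValNat p (Nat.card (A ⧸ (IwasawaAlgebra p) ∙ ι (Submodule.Quotient.mk z))) +
        muInvariant p H2 := by
  haveI := hfin
  have hp : p.Prime := Fact.out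
  set Q := H ⧸ (IwasawaAlgebra p) ∙ z with hQ
  -- `#(H2/TH2) = #H2[T] · p^{e(H2)}`
  obtain ⟨hfin2T, hcard2⟩ := natCard_coinvariants_eq_of_finite H2 hH2 hfin
  haveI := hfin2T
  -- `[A : Λ·ι z̄] = #H2[T] · #((H/Λz)/T)`, so `(H/Λz)/T` is finite
  have hA : Nat.card (A ⧸ (IwasawaAlgebra p) ∙ ι (Submodule.Quotient.mk z)) =
      Nat.card (invariants p H2) * Nat.card (coinvariants p Q) := by
    rw [natCard_quotient_eq_of_exact ι π hι hπ hex, ← natCard_coinvariants_quotient_span z]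
  have hneQ : Nat.card (coinvariants p Q) ≠ 0 := by
    intro h0
    rw [h0, mul_zero] at hA
    exact hne hA
  have hfinQ : Finite (coinvariants p Q) := Nat.finite_of_card_ne_zero hneQ
  have hTQ : Module.lengthAt (IwasawaAlgebra p) Q (primeT p) = 0 :=
    lengthAt_primeT_eq_zero_of_finite_coinvariants Q hHZ hfinQ
  obtain ⟨hfinQT, -, hcardQ⟩ := card_coinvariants_of_lengthAt_eq_zero Q hHZ hTQ
  rw [natCard_invariants_quotient_span_eq_one z hz hfinQT, one_mul] at hcardQ
  -- `e(H2) ≤ e(H/Λz) + μ(H2)`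
  have hle : eulerExp p H2 ≤ eulerExp p Q + muInvariant p H2 :=
    eulerExp_le_add_muInvariant_of_lengthAt_le_off_augIdealP hH2 hHZ hdiv
  -- valuations
  have hinv0 : Nat.card (invariants p H2) ≠ 0 := (Nat.card_pos (α := invariants p H2)).ne'
  have hpow0 : ∀ n : ℕ, p ^ n ≠ 0 := fun n ↦ pow_ne_zero n hp.ne_zero
  haveI : Fact p.Prime := ⟨hp⟩
  rw [hcard2, hA, hcardQ, padicValNat.mul hinv0 (hpow0 _), padicValNat.mul hinv0 (hpow0 _),
    padicValNat.prime_pow, padicValNat.prime_pow]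
  omega

/-- **Thm. 14.5 (3) from the divisibility OFF `(p)` plus `μ(H2) = 0`**: `[A : Λ·ι z̄] = p^m · #(H2/TH2)`
for some `m ≥ 0`. When the `μ`-invariant of `𝐇²(T)` vanishes, the divisibility at `(p)` (the only
use of Thm. 12.5 (4) in §14.14) holds trivially, so Kato's inequality follows from Thm. 12.5 (3)
alone. [cite: Kato2004Asterisque, Thm. 12.5 (3)–(4) (p. 222), Thm. 14.5 (3) (p. 236), §14.14 and Lemma 14.15 (pp. 243–244)]
[cite: Washington1997, §13.2] -/
theorem exists_index_zeta_eq_pow_mul_natCard_coinvariants_of_muInvariant_eq_zero (z : H)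
    (hz : z ≠ 0) (hHZ : Module.IsTorsion (IwasawaAlgebra p) (H ⧸ (IwasawaAlgebra p) ∙ z))
    (hH2 : Module.IsTorsion (IwasawaAlgebra p) H2)
    (hdiv : ∀ 𝔮 : PrimeSpectrum (IwasawaAlgebra p), 𝔮.asIdeal.height = 1 →
      𝔮.asIdeal ≠ augIdealP p →
      Module.lengthAt (IwasawaAlgebra p) H2 𝔮 ≤
        Module.lengthAt (IwasawaAlgebra p) (H ⧸ (IwasawaAlgebra p) ∙ z) 𝔮)
    (hμ : muInvariant p H2 = 0)
    (ι : coinvariants p H →ₗ[IwasawaAlgebra p] A) (π : A →ₗ[IwasawaAlgebra p] invariants p H2)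
    (hι : Function.Injective ι) (hπ : Function.Surjective π) (hex : Function.Exact ι π)
    (hfin : Finite (coinvariants p H2))
    (hne : Nat.card (A ⧸ (IwasawaAlgebra p) ∙ ι (Submodule.Quotient.mk z)) ≠ 0) :
    ∃ m : ℕ, Nat.card (A ⧸ (IwasawaAlgebra p) ∙ ι (Submodule.Quotient.mk z)) =
      p ^ m * Nat.card (coinvariants p H2) := by
  -- with `μ(H2) = 0` the divisibility holds at EVERY height-one prime
  have hdiv' : ∀ 𝔮 : PrimeSpectrum (IwasawaAlgebra p), 𝔮.asIdeal.height = 1 →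
      Module.lengthAt (IwasawaAlgebra p) H2 𝔮 ≤
        Module.lengthAt (IwasawaAlgebra p) (H ⧸ (IwasawaAlgebra p) ∙ z) 𝔮 := by
    intro 𝔮 h𝔮
    by_cases heq : 𝔮.asIdeal = augIdealP p
    · have h0 : Module.lengthAt (IwasawaAlgebra p) H2 𝔮 = 0 := by
        have hne' := Literature.NumberTheory.EllipticCurves.lengthAt_ne_top_of_isTorsion p H2 hH2 𝔮 heq
        have hto : (Module.lengthAt (IwasawaAlgebra p) H2 𝔮).toNat = 0 := by
          rw [← muInvariant_eq_toNat_lengthAt p H2 𝔮 heq, hμ]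
        rcases (ENat.toNat_eq_zero.mp hto) with h | h
        · exact h
        · exact absurd h hne'
      rw [h0]
      exact zero_le
    · exact hdiv 𝔮 h𝔮 heq
  exact exists_index_zeta_eq_pow_mul_natCard_coinvariants_of_index_ne_zero z hz hHZ hH2 hdiv' ι π hι
    hπ hex hfin hne

end Inequality

end Literature.NumberTheory.EllipticCurves.Kato2004

end
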